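import Summits.HodgeConjecture.HodgeConjecture.Theorems.Ring2WeilCoverageCMFieldRationalClassesPrimeSupport
import HarnessLib

/-!
# Ring 2 — Weil-family coverage, CM-field rows: fibre tools for the cyclic tables — inert fibres, split fibres, the
  uniformiser symbol, and three parity lemmas (WEIL-FAMILY-COVERAGE «## b03», cell (xxi⁸), part 47)

research route conditional on HC_CM; not a corollary; Q11.4-sentence-2 already refuted in dim ≥ 3.

Tools for the instances of part 46 (the union statement for the five cyclic quartic CM fields), on a quadratic carrier
`R = S² + pS + q` (`F = ℚ[S]/(R)`, `E = F(√θ)`, rows labelled by `T(t) = {𝔭 : (t, θ)_𝔭 = -1}`)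
[cite: Deligne1982HodgeCycles, §4 (1), Cor. 4.2]:

* §135 **INERT FIBRES**: for an odd prime `ℓ` with `p² - 4q` and `q` non-squares mod `ℓ`, EVERY place `v ∋ ℓ` lies in
  `T(ℓ)` (it is `(ℓ)`, `ord_v ℓ = 1`, `θ` a `v`-unit non-square mod `v` — part 21's argument, membership form), and a
  place of norm `ℓ²` is the only place over `ℓ` [cite: Omeara1963, §63B Example 63:12];
* §136 **SPLIT FIBRES** (`q = s₀²` in `𝓞_F`): for an odd prime `ℓ ∤ q·(p² - 4q)` with `p² - 4q` a square mod `ℓ`, a bad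
  place `w ∋ ℓ` has a PARTNER: a second place `w' ≠ w` over `ℓ`, also bad, and every place over `ℓ` is `w` or `w'`
  (`N w = ℓ` since at norm `ℓ²` the residue of `θ` would be a rational integer — a root of `R̄` in `𝔽_ℓ` —, hence a square;
  `(ℓ) = w·w'`, `w' ≠ w` as `ord_w ℓ` is odd, `w'` bad by saturation (B) of part 33);
* §137 **THE UNIFORMISER SYMBOL**, membership form of part 27 (c): `θ = π·t`, `-t` a non-square and `w` a square mod
  `v ∤ 2` ⟹ `v ∈ T(π·w)` [cite: Omeara1963, §63 Example 63:12];
* §138 **THREE PARITY LEMMAS** (Hilbert reciprocity, part 6: `x ∈ T(ℓ) ⟺ #(T(ℓ) ∖ {x})` odd): with one dyadic place `v₂`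
  and no infinite place in `T(ℓ)`, (a) if the other bad places are a distinguished `v_d ∌ ℓ` together with ONE full
  inert fibre, or a split PAIR, then `v₂ ∉ T(ℓ)`; (b) if they form ONE place then `v₂ ∈ T(ℓ)`; (c) if they form a
  split pair then `v₂ ∉ T(ℓ)` [cite: Omeara1963, §71D Thm. 71:18].

No new definition, no named fact, no sorry; nothing about the Hodge conjecture is asserted.
-/

noncomputable section

set_option linter.dupNamespace false

open Polynomial NumberField IsDedekindDomain

namespace Summit.HodgeConjecture.HodgeConjecture.Ring2.WeilCoverageCM

open Literature.AlgebraicGeometry.Deligne1982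
open Literature.AlgebraicGeometry.HodgeTheory (splitDiscriminantClassCM)
open Literature.NumberTheory.QuadraticForms

variable {R : Polynomial ℤ} [Fact (Irreducible (cmPolyQ R))] [Fact (Irreducible (realPolyQ R))]

/-! ### §135 Inert fibres -/

section AnyField

variable {K : Type*} [Field K] [NumberField K]

/-- **A place of norm `ℓ²` in a quadratic field is the ONLY place over `ℓ`** (it is `(ℓ)`, which is then maximal).
[folklore] -/
theorem eq_of_natCast_mem_of_absNorm_eq_sq (hK : Module.finrank ℚ K = 2) {ℓ : ℕ} (hℓ : ℓ.Prime)
    (v v' : HeightOneSpectrum (𝓞 K)) (hv : (ℓ : 𝓞 K) ∈ v.asIdeal) (hv' : (ℓ : 𝓞 K) ∈ v'.asIdeal)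
    (hN : Ideal.absNorm v.asIdeal = ℓ ^ 2) : v' = v := by
  obtain ⟨hspan, -, -⟩ := asIdeal_eq_span_of_absNorm_eq_sq hK hℓ v hv hN
  have hle : v.asIdeal ≤ v'.asIdeal := by rw [hspan]; exact (Ideal.span_singleton_le_iff_mem _).2 hv'
  exact HeightOneSpectrum.ext (v.isMaximal.eq_of_le v'.isPrime.ne_top hle).symm

end AnyField

omit [Fact (Irreducible (cmPolyQ R))] in
/-- If `θₒ ∈ v` then `q = -θ(θ + p) ∈ v`; so **`θₒ ∉ v` at every place `v ∋ ℓ` with `ℓ ∤ q`**. [folklore] -/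
theorem root_notMem_of_not_dvd {p q : ℤ} (hR : R = X ^ 2 + C p * X + C q) {θₒ : 𝓞 (realField R)}
    (hθ : (θₒ : realField R) = AdjoinRoot.root (realPolyQ R)) {ℓ : ℕ} (hℓ : ℓ.Prime) (hℓq : ¬ (ℓ : ℤ) ∣ q)
    (v : HeightOneSpectrum (𝓞 (realField R))) (hℓv : (ℓ : 𝓞 (realField R)) ∈ v.asIdeal) : θₒ ∉ v.asIdeal :=
  fun h ↦ hℓq ((intCast_mem_iff_natCast_dvd hℓ v hℓv q).1 (intCast_mem_of_root_mem hR hθ v h))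

omit [Fact (Irreducible (cmPolyQ R))] in
/-- A place containing an odd prime `ℓ` is not dyadic. [folklore] -/
theorem two_notMem_of_natCast_mem {ℓ : ℕ} (hℓ : ℓ.Prime) (hℓ2 : ℓ ≠ 2) (v : HeightOneSpectrum (𝓞 (realField R)))
    (hℓv : (ℓ : 𝓞 (realField R)) ∈ v.asIdeal) : (2 : 𝓞 (realField R)) ∉ v.asIdeal := fun h2 ↦
  hℓ2 (prime_natCast_mem_unique hℓ Nat.prime_two v hℓv (by exact_mod_cast h2))

/-- **INERT FIBRES ARE BAD**: for an odd prime `ℓ` with `p² - 4q` AND `q` non-squares mod `ℓ`, every place `v ∋ ℓ` lies in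
`T(ℓ)` — `v = (ℓ)`, `ord_v ℓ = 1`, `θ` is a `v`-unit and a non-square mod `v` (part 21), so `(ℓ, θ)_v = -1` by O'Meara 63:12.
[cite: Omeara1963, §63B Example 63:12] [cite: Deligne1982HodgeCycles, §4 (1)] -/
theorem inl_mem_badPlaces_natCast_of_not_isSquare_disc_const {p q : ℤ} (hR : R = X ^ 2 + C p * X + C q)
    {θₒ : 𝓞 (realField R)} (hθ : (θₒ : realField R) = AdjoinRoot.root (realPolyQ R)) {ℓ : ℕ} (hℓ : ℓ.Prime) (hℓ2 : ℓ ≠ 2)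
    (hdisc : ¬ IsSquare ((p ^ 2 - 4 * q : ℤ) : ZMod ℓ)) (hq : ¬ IsSquare ((q : ℤ) : ZMod ℓ))
    (v : HeightOneSpectrum (𝓞 (realField R))) (hℓv : (ℓ : 𝓞 (realField R)) ∈ v.asIdeal) :
    Sum.inl v ∈ badPlaces (ℓ : realField R) (AdjoinRoot.root (realPolyQ R)) := by
  have hK := finrank_realField_quadratic hR
  have hN := absNorm_eq_sq_of_not_isSquare_disc hR hθ hℓ hdisc v hℓv
  obtain ⟨-, hval, -⟩ := asIdeal_eq_span_of_absNorm_eq_sq hK hℓ v hℓv hN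
  have h2 := two_notMem_of_natCast_mem hℓ hℓ2 v hℓv
  have hq0 : ¬ (ℓ : ℤ) ∣ q := fun h ↦ hq (by
    rw [(ZMod.intCast_zmod_eq_zero_iff_dvd q ℓ).2 h]; exact IsSquare.zero)
  have hθv := root_notMem_of_not_dvd hR hθ hℓ hq0 v hℓv
  have hns := not_isSquare_residue_root_of_not_isSquare_disc_const hR hθ hℓ hdisc hq v hℓv
  have hfac : AdjoinRoot.root (realPolyQ R) = (1 : realField R) ^ 2 * (θₒ : realField R) := by rw [one_pow, one_mul, hθ]
  refine (inl_mem_badPlaces_natCast_iff_of_notMem hfac v h2 hθv hℓ).2 ⟨hns, ?_⟩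
  rw [show (ℓ : realField R) = algebraMap (𝓞 (realField R)) (realField R) (ℓ : 𝓞 (realField R)) by rw [map_natCast],
    HeightOneSpectrum.valuation_of_algebraMap, hval, WithZero.log_exp]
  decide

/-! ### §136 Split fibres: the partner of a bad place -/

/-- **THE PARTNER OF A BAD PLACE OVER A SPLIT PRIME.** `R = S² + pS + q` with `q = s₀²` in `𝓞_F`; `ℓ` an odd prime with
`ℓ ∤ q`, `ℓ ∤ p² - 4q` and `p² - 4q` a square mod `ℓ`; `w ∋ ℓ` a place in `T(ℓ)`. Then there is a second place `w' ≠ w` over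
`ℓ`, also in `T(ℓ)`, and every place over `ℓ` is `w` or `w'` (`N w = ℓ`: at norm `ℓ²` the residue of `θ` is a root of `R̄`
in `𝔽_ℓ`, a rational integer, hence a square; so `(ℓ) = w·w'` with `N w' = ℓ`, `w' ≠ w` because `ord_w ℓ` is odd, and `w'`
is bad by part 33 (B)). [cite: Omeara1963, §63B Cor. 63:11a and Example 63:12] [cite: Deligne1982HodgeCycles, §4 (1)] -/
theorem exists_partner_of_isSquare_disc {p q : ℤ} (hR : R = X ^ 2 + C p * X + C q)
    {θₒ s₀ : 𝓞 (realField R)} (hθ : (θₒ : realField R) = AdjoinRoot.root (realPolyQ R)) (hs : s₀ ^ 2 = q)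
    {ℓ : ℕ} (hℓ : ℓ.Prime) (hℓ2 : ℓ ≠ 2) (hℓq : ¬ (ℓ : ℤ) ∣ q) (hℓdisc : ¬ (ℓ : ℤ) ∣ p ^ 2 - 4 * q)
    (hdsq : IsSquare ((p ^ 2 - 4 * q : ℤ) : ZMod ℓ)) (w : HeightOneSpectrum (𝓞 (realField R)))
    (hℓw : (ℓ : 𝓞 (realField R)) ∈ w.asIdeal) (hw : Sum.inl w ∈ badPlaces (ℓ : realField R) (AdjoinRoot.root (realPolyQ R))) :
    ∃ w' : HeightOneSpectrum (𝓞 (realField R)), w' ≠ w ∧ (ℓ : 𝓞 (realField R)) ∈ w'.asIdeal ∧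
      Sum.inl w' ∈ badPlaces (ℓ : realField R) (AdjoinRoot.root (realPolyQ R)) ∧
        ∀ u : HeightOneSpectrum (𝓞 (realField R)), (ℓ : 𝓞 (realField R)) ∈ u.asIdeal → u = w ∨ u = w' := by
  have hK := finrank_realField_quadratic hR
  have hrel := ringOfIntegers_root_rel_quadratic hR hθ
  have h2w := two_notMem_of_natCast_mem hℓ hℓ2 w hℓw
  have hθw := root_notMem_of_not_dvd hR hθ hℓ hℓq w hℓw
  have hfac : AdjoinRoot.root (realPolyQ R) = (1 : realField R) ^ 2 * (θₒ : realField R) := by rw [one_pow, one_mul, hθ]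
  obtain ⟨hns, hodd⟩ := (inl_mem_badPlaces_natCast_iff_of_notMem hfac w h2w hθw hℓ).1 hw
  -- `N w = ℓ`
  have hNw : Ideal.absNorm w.asIdeal = ℓ := by
    rcases absNorm_eq_or_eq_sq_of_natCast_mem hK w hℓ hℓw with h | h
    · exact h
    · exfalso
      obtain ⟨s₁, hs₁⟩ := hdsq
      obtain ⟨s, rfl⟩ := ZMod.intCast_surjective s₁
      have hsd : (ℓ : ℤ) ∣ s * s - (p ^ 2 - 4 * q) := by
        rw [← ZMod.intCast_zmod_eq_zero_iff_dvd]; push_cast; rw [← hs₁]; push_cast; ring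
      obtain ⟨r, -, hR1, -⟩ := exists_root_mod_of_sq_sub_disc_dvd hℓ hℓ2 hℓdisc hsd
      have e : ((r ^ 2 + p * r + q : ℤ) : 𝓞 (realField R)) = (θₒ - r) * (-θₒ - r - p) := by
        push_cast; linear_combination hrel
      have hmem : (θₒ - r) * (-θₒ - r - p) ∈ w.asIdeal := by
        rw [← e]; exact (intCast_mem_iff_natCast_dvd hℓ w hℓw _).2 hR1
      apply hns
      rcases w.isPrime.mem_or_mem hmem with h1 | h1
      · rw [Ideal.Quotient.eq.2 h1]
        exact isSquare_intCast_residue_of_absNorm_eq_sq w hℓ h r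
      · have h1' : θₒ - ((-r - p : ℤ) : 𝓞 (realField R)) ∈ w.asIdeal := by
          have e1 : θₒ - ((-r - p : ℤ) : 𝓞 (realField R)) = -(-θₒ - r - p) := by push_cast; ring
          rw [e1]; exact w.asIdeal.neg_mem h1
        rw [Ideal.Quotient.eq.2 h1']
        exact isSquare_intCast_residue_of_absNorm_eq_sq w hℓ h (-r - p)
  -- `(ℓ) = w · J` with `N J = ℓ`: `J` is a second place `w'` over `ℓ`
  obtain ⟨J, hJ⟩ := Ideal.dvd_iff_le.2 ((Ideal.span_singleton_le_iff_mem _).2 hℓw)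
  have hNJ : Ideal.absNorm J = ℓ := by
    have h := congrArg Ideal.absNorm hJ
    rw [absNorm_span_natCast, hK, map_mul, hNw] at h
    have h' : ℓ * Ideal.absNorm J = ℓ * ℓ := by rw [← h]; ring
    exact Nat.eq_of_mul_eq_mul_left hℓ.pos h'
  have hJprime : J.IsPrime := Ideal.isPrime_of_irreducible_absNorm (by rw [hNJ]; exact hℓ)
  have hJne : J ≠ ⊥ := fun h ↦ hℓ.ne_zero (by rw [← hNJ, h, Ideal.absNorm_bot])
  set w' : HeightOneSpectrum (𝓞 (realField R)) := ⟨J, hJprime, hJne⟩ with hw'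
  have hℓw' : (ℓ : 𝓞 (realField R)) ∈ w'.asIdeal := by
    have hle : Ideal.span {(ℓ : 𝓞 (realField R))} ≤ J := by rw [hJ]; exact Ideal.mul_le_left
    exact hle (Ideal.mem_span_singleton_self _)
  have hunit : ¬ IsUnit w.asIdeal := fun hu ↦ w.isPrime.ne_top (Ideal.isUnit_iff.1 hu)
  have hww' : w ≠ w' := by
    intro h
    have hJw : J = w.asIdeal := (congrArg HeightOneSpectrum.asIdeal h).symm
    have hsq : Ideal.span {(ℓ : 𝓞 (realField R))} = w.asIdeal ^ 2 := by rw [hJ, hJw, sq]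
    have hval : w.intValuation (ℓ : 𝓞 (realField R)) = WithZero.exp (-(2 : ℕ) : ℤ) := by
      refine intValuation_eq_exp_neg_of_mem_of_notMem w 2 ?_ ?_
      · rw [← hsq]; exact Ideal.mem_span_singleton_self _
      · intro h3
        have hdvd : w.asIdeal ^ 3 ∣ w.asIdeal ^ 2 := by
          rw [← hsq]; exact Ideal.dvd_iff_le.2 ((Ideal.span_singleton_le_iff_mem _).2 h3)
        have := (pow_dvd_pow_iff w.ne_bot hunit).1 hdvd
        omega
    have hlog : WithZero.log (w.valuation (realField R) (ℓ : realField R)) = -2 := by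
      rw [show (ℓ : realField R) = algebraMap (𝓞 (realField R)) (realField R) (ℓ : 𝓞 (realField R)) from
        (map_natCast _ ℓ).symm, HeightOneSpectrum.valuation_of_algebraMap, hval, WithZero.log_exp]
      norm_num
    rw [hlog] at hodd
    exact (Int.not_odd_iff_even.2 ⟨-1, by norm_num⟩) hodd
  have hw'T : Sum.inl w' ∈ badPlaces (ℓ : realField R) (AdjoinRoot.root (realPolyQ R)) := by
    have h := (inl_mem_badPlaces_ratCast_iff_of_sq_eq hR hθ hs hℓ hℓ2 hℓq w w' hℓw hℓw'
      (c := (ℓ : ℚ)) (by exact_mod_cast hℓ.ne_zero)).1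
    rw [Rat.cast_natCast] at h
    exact h hw
  obtain ⟨hprod, -⟩ := span_natCast_eq_mul_of_ne hK hℓ w w' hww' hℓw hℓw'
  refine ⟨w', Ne.symm hww', hℓw', hw'T, fun u hℓu ↦ ?_⟩
  have hle : w.asIdeal * w'.asIdeal ≤ u.asIdeal := by
    rw [← hprod]; exact (Ideal.span_singleton_le_iff_mem _).2 hℓu
  rcases u.isPrime.mul_le.1 hle with h | h
  · exact Or.inl (HeightOneSpectrum.ext (w.isMaximal.eq_of_le u.isPrime.ne_top h)).symm
  · exact Or.inr (HeightOneSpectrum.ext (w'.isMaximal.eq_of_le u.isPrime.ne_top h)).symm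

/-! ### §137 The uniformiser symbol, membership form -/

omit [Fact (Irreducible (cmPolyQ R))] in
/-- **`v ∈ T(π·w)`** when `θ = π·t` with `π` a uniformiser at the non-dyadic place `v`, `t ∉ v`, `-t` a NON-square mod `v`,
and `w ∉ v` a square mod `v`: `(π w, π t)_v = -1` (O'Meara 63:12: `(πa, πb)_v = 1 ⟺ -ab` is a square mod `v`). The membership
form of part 27 (c). [cite: Omeara1963, §63 Example 63:12] [cite: Deligne1982HodgeCycles, §4 (1)] -/
theorem inl_mem_badPlaces_coe_of_uniformizer_mul {θₒ t π w : 𝓞 (realField R)}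
    (hθ : (θₒ : realField R) = AdjoinRoot.root (realPolyQ R)) (v : HeightOneSpectrum (𝓞 (realField R)))
    (h2 : (2 : 𝓞 (realField R)) ∉ v.asIdeal) (hπ : v.intValuation π = WithZero.exp (-1 : ℤ)) (hθt : θₒ = π * t)
    (ht : t ∉ v.asIdeal) (hns : ¬ IsSquare (Ideal.Quotient.mk v.asIdeal (-t)))
    (hwv : w ∉ v.asIdeal) (hwsq : IsSquare (Ideal.Quotient.mk v.asIdeal w)) :
    Sum.inl v ∈ badPlaces (((π * w : 𝓞 (realField R))) : realField R) (AdjoinRoot.root (realPolyQ R)) := by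
  haveI : v.asIdeal.IsMaximal := v.isMaximal
  have hnsq : ¬ IsSquare (Ideal.Quotient.mk v.asIdeal (-(w * t))) := by
    letI : Field (𝓞 (realField R) ⧸ v.asIdeal) := Ideal.Quotient.field v.asIdeal
    intro h
    have hw0 : Ideal.Quotient.mk v.asIdeal w ≠ 0 := fun h0 ↦ hwv ((Ideal.Quotient.eq_zero_iff_mem).1 h0)
    apply hns
    have e : Ideal.Quotient.mk v.asIdeal (-t) =
        Ideal.Quotient.mk v.asIdeal (-(w * t)) * (Ideal.Quotient.mk v.asIdeal w)⁻¹ := by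
      rw [map_neg, map_neg, map_mul, neg_mul, mul_comm ((Ideal.Quotient.mk v.asIdeal) w) ((Ideal.Quotient.mk v.asIdeal) t),
        mul_inv_cancel_right₀ hw0]
    rw [e]
    exact h.mul hwsq.inv
  have key := hilbertSymbol_uniformizer_mul_uniformizer_mul_iff (realField R) v h2 hπ hwv ht
  have hsym : hilbertSymbol (v.adicCompletion (realField R))
      (algebraMap (𝓞 (realField R)) _ (π * w)) (algebraMap (𝓞 (realField R)) _ (π * t)) = -1 :=
    (hilbertSymbol_eq_one_or_eq_neg_one _ _).resolve_left fun h ↦ hnsq (key.1 h)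
  rw [mem_badPlaces_iff, placeSymbol_inl, ← hθ, hθt,
    ← IsScalarTower.algebraMap_apply (𝓞 (realField R)) (realField R) (v.adicCompletion (realField R)),
    show ((π * t : 𝓞 (realField R)) : realField R) = algebraMap (𝓞 (realField R)) (realField R) (π * t) from rfl,
    ← IsScalarTower.algebraMap_apply (𝓞 (realField R)) (realField R) (v.adicCompletion (realField R))]
  exact hsym

/-! ### §138 Three parity lemmas at the dyadic place -/

/-- **(a) DYADIC EXCLUSION BY FIBRE PARITY.** `F` with one dyadic place `v₂` (roots of `R` real negative), a distinguished
non-dyadic place `v_d`, and an odd prime `ℓ` such that: every non-dyadic bad place is `v_d` or contains `ℓ`; if `v_d` is bad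
then `ℓ ∉ v_d`, some place over `ℓ` is bad and the place over `ℓ` is unique (INERT); if `v_d` is not bad then every bad place
over `ℓ` has a bad partner and the two exhaust the places over `ℓ` (SPLIT). Then `T(ℓ) ∖ {v₂}` has 2 or 0/2 elements, and
**`v₂ ∉ T(ℓ)`** by Hilbert reciprocity. [cite: Omeara1963, §71D Thm. 71:18] [cite: Deligne1982HodgeCycles, §4 (1)] -/
theorem inl_notMem_badPlaces_natCast_of_fibre_parity
    (hroots : ∀ s : ℂ, Polynomial.eval₂ (Int.castRingHom ℂ) s R = 0 → s.im = 0 ∧ s.re < 0)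
    (v₂ v_d : HeightOneSpectrum (𝓞 (realField R))) (hv₂ : (2 : 𝓞 (realField R)) ∈ v₂.asIdeal)
    (huniq2 : ∀ u : HeightOneSpectrum (𝓞 (realField R)), (2 : 𝓞 (realField R)) ∈ u.asIdeal → u = v₂)
    (h2d : (2 : 𝓞 (realField R)) ∉ v_d.asIdeal) {ℓ : ℕ} (hℓ : ℓ.Prime) (hℓ2 : ℓ ≠ 2)
    (H1 : ∀ u : HeightOneSpectrum (𝓞 (realField R)), (2 : 𝓞 (realField R)) ∉ u.asIdeal →
      Sum.inl u ∈ badPlaces (ℓ : realField R) (AdjoinRoot.root (realPolyQ R)) → u = v_d ∨ (ℓ : 𝓞 (realField R)) ∈ u.asIdeal)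
    (H2 : Sum.inl v_d ∈ badPlaces (ℓ : realField R) (AdjoinRoot.root (realPolyQ R)) →
      (ℓ : 𝓞 (realField R)) ∉ v_d.asIdeal ∧
        (∃ u : HeightOneSpectrum (𝓞 (realField R)), (ℓ : 𝓞 (realField R)) ∈ u.asIdeal ∧
          Sum.inl u ∈ badPlaces (ℓ : realField R) (AdjoinRoot.root (realPolyQ R))) ∧
        ∀ u u' : HeightOneSpectrum (𝓞 (realField R)), (ℓ : 𝓞 (realField R)) ∈ u.asIdeal →
          (ℓ : 𝓞 (realField R)) ∈ u'.asIdeal → u = u')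
    (H3 : Sum.inl v_d ∉ badPlaces (ℓ : realField R) (AdjoinRoot.root (realPolyQ R)) →
      ∀ w : HeightOneSpectrum (𝓞 (realField R)), (ℓ : 𝓞 (realField R)) ∈ w.asIdeal →
        Sum.inl w ∈ badPlaces (ℓ : realField R) (AdjoinRoot.root (realPolyQ R)) →
        ∃ w' : HeightOneSpectrum (𝓞 (realField R)), w' ≠ w ∧ (ℓ : 𝓞 (realField R)) ∈ w'.asIdeal ∧
          Sum.inl w' ∈ badPlaces (ℓ : realField R) (AdjoinRoot.root (realPolyQ R)) ∧
          ∀ u : HeightOneSpectrum (𝓞 (realField R)), (ℓ : 𝓞 (realField R)) ∈ u.asIdeal → u = w ∨ u = w') :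
    Sum.inl v₂ ∉ badPlaces (ℓ : realField R) (AdjoinRoot.root (realPolyQ R)) := by
  intro hmem
  have hℓ0 : (ℓ : realField R) ≠ 0 := by exact_mod_cast hℓ.ne_zero
  have hpar := (mem_badPlaces_iff_odd_ncard_diff_singleton (R := R) (Units.mk0 (ℓ : realField R) hℓ0)
    (Sum.inl v₂)).1 (by rwa [Units.val_mk0])
  rw [Units.val_mk0] at hpar
  have h2u : ∀ u : HeightOneSpectrum (𝓞 (realField R)), (ℓ : 𝓞 (realField R)) ∈ u.asIdeal →
      (2 : 𝓞 (realField R)) ∉ u.asIdeal := fun u hu ↦ two_notMem_of_natCast_mem hℓ hℓ2 u hu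
  have key : ∀ x ∈ badPlaces (ℓ : realField R) (AdjoinRoot.root (realPolyQ R)) \ {Sum.inl v₂},
      ∃ u : HeightOneSpectrum (𝓞 (realField R)), x = Sum.inl u ∧ (2 : 𝓞 (realField R)) ∉ u.asIdeal ∧
        Sum.inl u ∈ badPlaces (ℓ : realField R) (AdjoinRoot.root (realPolyQ R)) := by
    rintro x ⟨hx, hxne⟩
    rcases x with u | w
    · exact ⟨u, rfl, fun h2 ↦ hxne (by rw [Set.mem_singleton_iff, huniq2 u h2]), hx⟩
    · exact absurd hx (inr_notMem_badPlaces_natCast hroots w hℓ)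
  have hne2 : ∀ u : HeightOneSpectrum (𝓞 (realField R)), (2 : 𝓞 (realField R)) ∉ u.asIdeal →
      (Sum.inl u : HeightOneSpectrum (𝓞 (realField R)) ⊕ InfinitePlace (realField R)) ∉ ({Sum.inl v₂} : Set _) := by
    intro u h2 h
    rw [Set.mem_singleton_iff, Sum.inl.injEq] at h
    exact h2 (by rw [h]; exact hv₂)
  by_cases hd : Sum.inl v_d ∈ badPlaces (ℓ : realField R) (AdjoinRoot.root (realPolyQ R))
  · obtain ⟨hℓd, ⟨u, hℓu, hu⟩, huniq⟩ := H2 hd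
    have hS : badPlaces (ℓ : realField R) (AdjoinRoot.root (realPolyQ R)) \ {Sum.inl v₂} = {Sum.inl v_d, Sum.inl u} := by
      apply Set.Subset.antisymm
      · intro x hx
        obtain ⟨u', rfl, h2u', hu'⟩ := key x hx
        rcases H1 u' h2u' hu' with rfl | hℓu'
        · exact Set.mem_insert _ _
        · rw [huniq u' u hℓu' hℓu]; exact Set.mem_insert_of_mem _ (Set.mem_singleton _)
      · intro x hx
        rw [Set.mem_insert_iff, Set.mem_singleton_iff] at hx
        rcases hx with rfl | rfl
        · exact ⟨hd, hne2 v_d h2d⟩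
        · exact ⟨hu, hne2 u (h2u u hℓu)⟩
    have hne : (Sum.inl v_d : HeightOneSpectrum (𝓞 (realField R)) ⊕ InfinitePlace (realField R)) ≠ Sum.inl u :=
      fun h ↦ hℓd (by rw [Sum.inl_injective h]; exact hℓu)
    rw [hS, Set.ncard_pair hne] at hpar
    exact (Nat.not_odd_iff_even.2 ⟨1, rfl⟩) hpar
  · by_cases hS0 : badPlaces (ℓ : realField R) (AdjoinRoot.root (realPolyQ R)) \ {Sum.inl v₂} = ∅
    · rw [hS0, Set.ncard_empty] at hpar
      exact (Nat.not_odd_iff_even.2 ⟨0, rfl⟩) hpar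
    · obtain ⟨x, hx⟩ := Set.nonempty_iff_ne_empty.2 hS0
      obtain ⟨w, rfl, h2w, hw⟩ := key x hx
      have hℓw : (ℓ : 𝓞 (realField R)) ∈ w.asIdeal := (H1 w h2w hw).resolve_left fun h ↦ hd (h ▸ hw)
      obtain ⟨w', hw'w, hℓw', hw', hall⟩ := H3 hd w hℓw hw
      have hS : badPlaces (ℓ : realField R) (AdjoinRoot.root (realPolyQ R)) \ {Sum.inl v₂} = {Sum.inl w, Sum.inl w'} := by
        apply Set.Subset.antisymm
        · intro y hy
          obtain ⟨u', rfl, h2u', hu'⟩ := key y hy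
          have hℓu' : (ℓ : 𝓞 (realField R)) ∈ u'.asIdeal := (H1 u' h2u' hu').resolve_left fun h ↦ hd (h ▸ hu')
          rcases hall u' hℓu' with rfl | rfl
          · exact Set.mem_insert _ _
          · exact Set.mem_insert_of_mem _ (Set.mem_singleton _)
        · intro y hy
          rw [Set.mem_insert_iff, Set.mem_singleton_iff] at hy
          rcases hy with rfl | rfl
          · exact hx
          · exact ⟨hw', hne2 w' (h2u w' hℓw')⟩
      have hne : (Sum.inl w : HeightOneSpectrum (𝓞 (realField R)) ⊕ InfinitePlace (realField R)) ≠ Sum.inl w' :=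
        fun h ↦ hw'w (Sum.inl_injective h).symm
      rw [hS, Set.ncard_pair hne] at hpar
      exact (Nat.not_odd_iff_even.2 ⟨1, rfl⟩) hpar

/-- **(b) DYADIC MEMBERSHIP BY FIBRE PARITY (inert).** One dyadic place `v₂`, an odd prime `ℓ`, every non-dyadic bad place
contains `ℓ`, the place `u₀` over `ℓ` is unique and bad: then `T(ℓ) ∖ {v₂} = {u₀}` and **`v₂ ∈ T(ℓ)`**.
[cite: Omeara1963, §71D Thm. 71:18] [cite: Deligne1982HodgeCycles, §4 (1)] -/
theorem inl_mem_badPlaces_natCast_of_diff_singleton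
    (hroots : ∀ s : ℂ, Polynomial.eval₂ (Int.castRingHom ℂ) s R = 0 → s.im = 0 ∧ s.re < 0)
    (v₂ : HeightOneSpectrum (𝓞 (realField R))) (hv₂ : (2 : 𝓞 (realField R)) ∈ v₂.asIdeal)
    (huniq2 : ∀ u : HeightOneSpectrum (𝓞 (realField R)), (2 : 𝓞 (realField R)) ∈ u.asIdeal → u = v₂)
    {ℓ : ℕ} (hℓ : ℓ.Prime) (hℓ2 : ℓ ≠ 2)
    (H1 : ∀ u : HeightOneSpectrum (𝓞 (realField R)), (2 : 𝓞 (realField R)) ∉ u.asIdeal →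
      Sum.inl u ∈ badPlaces (ℓ : realField R) (AdjoinRoot.root (realPolyQ R)) → (ℓ : 𝓞 (realField R)) ∈ u.asIdeal)
    (u₀ : HeightOneSpectrum (𝓞 (realField R))) (hℓu₀ : (ℓ : 𝓞 (realField R)) ∈ u₀.asIdeal)
    (hu₀ : Sum.inl u₀ ∈ badPlaces (ℓ : realField R) (AdjoinRoot.root (realPolyQ R)))
    (huniq : ∀ u u' : HeightOneSpectrum (𝓞 (realField R)), (ℓ : 𝓞 (realField R)) ∈ u.asIdeal →
      (ℓ : 𝓞 (realField R)) ∈ u'.asIdeal → u = u') :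
    Sum.inl v₂ ∈ badPlaces (ℓ : realField R) (AdjoinRoot.root (realPolyQ R)) := by
  have hℓ0 : (ℓ : realField R) ≠ 0 := by exact_mod_cast hℓ.ne_zero
  have h := (mem_badPlaces_iff_odd_ncard_diff_singleton (R := R) (Units.mk0 (ℓ : realField R) hℓ0) (Sum.inl v₂))
  rw [Units.val_mk0] at h
  refine h.2 ?_
  have hS : badPlaces (ℓ : realField R) (AdjoinRoot.root (realPolyQ R)) \ {Sum.inl v₂} = {Sum.inl u₀} := by
    apply Set.Subset.antisymm
    · rintro x ⟨hx, hxne⟩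
      rcases x with u | w
      · have h2u : (2 : 𝓞 (realField R)) ∉ u.asIdeal := fun h2 ↦ hxne (by rw [Set.mem_singleton_iff, huniq2 u h2])
        rw [Set.mem_singleton_iff, huniq u u₀ (H1 u h2u hx) hℓu₀]
      · exact absurd hx (inr_notMem_badPlaces_natCast hroots w hℓ)
    · rintro x hx
      rw [Set.mem_singleton_iff] at hx
      subst hx
      refine ⟨hu₀, fun h ↦ ?_⟩
      rw [Set.mem_singleton_iff, Sum.inl.injEq] at h
      exact two_notMem_of_natCast_mem hℓ hℓ2 u₀ hℓu₀ (by rw [h]; exact hv₂)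
  rw [hS, Set.ncard_singleton]; exact odd_one

/-- **(c) DYADIC EXCLUSION BY FIBRE PARITY (split).** One dyadic place `v₂`, an odd prime `ℓ`, every non-dyadic bad place
contains `ℓ`, and every bad place over `ℓ` has a bad partner exhausting the places over `ℓ`: then `T(ℓ) ∖ {v₂}` is empty or a
pair and **`v₂ ∉ T(ℓ)`**. [cite: Omeara1963, §71D Thm. 71:18] [cite: Deligne1982HodgeCycles, §4 (1)] -/
theorem inl_notMem_badPlaces_natCast_of_diff_pair
    (hroots : ∀ s : ℂ, Polynomial.eval₂ (Int.castRingHom ℂ) s R = 0 → s.im = 0 ∧ s.re < 0)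
    (v₂ : HeightOneSpectrum (𝓞 (realField R))) (hv₂ : (2 : 𝓞 (realField R)) ∈ v₂.asIdeal)
    (huniq2 : ∀ u : HeightOneSpectrum (𝓞 (realField R)), (2 : 𝓞 (realField R)) ∈ u.asIdeal → u = v₂)
    {ℓ : ℕ} (hℓ : ℓ.Prime) (hℓ2 : ℓ ≠ 2)
    (H1 : ∀ u : HeightOneSpectrum (𝓞 (realField R)), (2 : 𝓞 (realField R)) ∉ u.asIdeal →
      Sum.inl u ∈ badPlaces (ℓ : realField R) (AdjoinRoot.root (realPolyQ R)) → (ℓ : 𝓞 (realField R)) ∈ u.asIdeal)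
    (H3 : ∀ w : HeightOneSpectrum (𝓞 (realField R)), (ℓ : 𝓞 (realField R)) ∈ w.asIdeal →
        Sum.inl w ∈ badPlaces (ℓ : realField R) (AdjoinRoot.root (realPolyQ R)) →
        ∃ w' : HeightOneSpectrum (𝓞 (realField R)), w' ≠ w ∧ (ℓ : 𝓞 (realField R)) ∈ w'.asIdeal ∧
          Sum.inl w' ∈ badPlaces (ℓ : realField R) (AdjoinRoot.root (realPolyQ R)) ∧
          ∀ u : HeightOneSpectrum (𝓞 (realField R)), (ℓ : 𝓞 (realField R)) ∈ u.asIdeal → u = w ∨ u = w') :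
    Sum.inl v₂ ∉ badPlaces (ℓ : realField R) (AdjoinRoot.root (realPolyQ R)) := by
  intro hmem
  have hℓ0 : (ℓ : realField R) ≠ 0 := by exact_mod_cast hℓ.ne_zero
  have hpar := (mem_badPlaces_iff_odd_ncard_diff_singleton (R := R) (Units.mk0 (ℓ : realField R) hℓ0)
    (Sum.inl v₂)).1 (by rwa [Units.val_mk0])
  rw [Units.val_mk0] at hpar
  have key : ∀ x ∈ badPlaces (ℓ : realField R) (AdjoinRoot.root (realPolyQ R)) \ {Sum.inl v₂},
      ∃ u : HeightOneSpectrum (𝓞 (realField R)), x = Sum.inl u ∧ (ℓ : 𝓞 (realField R)) ∈ u.asIdeal ∧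
        Sum.inl u ∈ badPlaces (ℓ : realField R) (AdjoinRoot.root (realPolyQ R)) := by
    rintro x ⟨hx, hxne⟩
    rcases x with u | w
    · have h2u : (2 : 𝓞 (realField R)) ∉ u.asIdeal := fun h2 ↦ hxne (by rw [Set.mem_singleton_iff, huniq2 u h2])
      exact ⟨u, rfl, H1 u h2u hx, hx⟩
    · exact absurd hx (inr_notMem_badPlaces_natCast hroots w hℓ)
  by_cases hS0 : badPlaces (ℓ : realField R) (AdjoinRoot.root (realPolyQ R)) \ {Sum.inl v₂} = ∅
  · rw [hS0, Set.ncard_empty] at hpar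
    exact (Nat.not_odd_iff_even.2 ⟨0, rfl⟩) hpar
  · obtain ⟨x, hx⟩ := Set.nonempty_iff_ne_empty.2 hS0
    obtain ⟨w, rfl, hℓw, hw⟩ := key x hx
    obtain ⟨w', hw'w, hℓw', hw', hall⟩ := H3 w hℓw hw
    have hS : badPlaces (ℓ : realField R) (AdjoinRoot.root (realPolyQ R)) \ {Sum.inl v₂} = {Sum.inl w, Sum.inl w'} := by
      apply Set.Subset.antisymm
      · intro y hy
        obtain ⟨u', rfl, hℓu', -⟩ := key y hy
        rcases hall u' hℓu' with rfl | rfl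
        · exact Set.mem_insert _ _
        · exact Set.mem_insert_of_mem _ (Set.mem_singleton _)
      · intro y hy
        rw [Set.mem_insert_iff, Set.mem_singleton_iff] at hy
        rcases hy with rfl | rfl
        · exact hx
        · refine ⟨hw', fun h ↦ ?_⟩
          rw [Set.mem_singleton_iff, Sum.inl.injEq] at h
          exact two_notMem_of_natCast_mem hℓ hℓ2 w' hℓw' (by rw [h]; exact hv₂)
    have hne : (Sum.inl w : HeightOneSpectrum (𝓞 (realField R)) ⊕ InfinitePlace (realField R)) ≠ Sum.inl w' :=
      fun h ↦ hw'w (Sum.inl_injective h).symm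
    rw [hS, Set.ncard_pair hne] at hpar
    exact (Nat.not_odd_iff_even.2 ⟨1, rfl⟩) hpar

end Summit.HodgeConjecture.HodgeConjecture.Ring2.WeilCoverageCM

end
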